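import Summits.CriticalPhenomena.SAWScalingLimit.Theorems.SAWDefectDecoherencePickHalfPlaneDefs
import Summits.CriticalPhenomena.SAWScalingLimit.Theorems.SAWDefectDecoherenceBoundaryClosureRBoundaryExactnessPhase
import Summits.CriticalPhenomena.SAWScalingLimit.Theorems.SAWDefectDecoherenceSpinShift
import Literature.Probability.RandomPlanarGeometry.HexParafermionProofs
import HarnessLib

/-!
# Crux `BoundaryClosureR` (stmt-CriticalPhenomena-14004), line `pick-half-plane`: the dressed
boundary-arrival identity and the one-sided bound on the `π`-class arrival mass

Lead helper file (serves `stub_halfPlaneInputs`); unconditional by the landed phase law (E2).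
* `boundaryTerm_sum_eq` — `Σ_{boundary darts ≠ root} (mid − c_v)F({v,t}) = (c_w − c_u)/2`;
* `dressed_sum_re_im` — normalised: `Σ Re(D/A) = 1`, `Σ Im(D/A) = 0`, `A = (c_w − c_u)/2` (the
  general-domain form of DCS's identity (5): by (E2) each reached dart has `D/A = e^{i(3/8)W} Z`);
* `tame_piClass_mass_le` — all windings in `[−π, π]` ⇒ `π`-class mass `≤ 1/(2cos(3π/8))` (sharp);
* `piClass_mass_le_general` (anchor `stub_halfPlaneInputs_piClassBudget`) — plus the overturned mass.
-/

noncomputable section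

open scoped BigOperators ComplexConjugate
open Literature.Probability.LatticeModels Literature.Probability.RandomPlanarGeometry
open Literature.Probability.RandomPlanarGeometry.SAW
open Literature.Barriers.CriticalPhenomena Literature.Barriers.CriticalPhenomena.HexGreen
open Summit.CriticalPhenomena.SAWScalingLimit.Theorems.PickHalfPlane

namespace Summit.CriticalPhenomena.SAWScalingLimit.Theorems.PickHalfPlane.Dressed

/-- The critical observable satisfies the vertex relations (DCS Lemma 1, proved in the tree). [cite: DuminilCopinSmirnov2012, Lemma 1] -/
theorem satisfiesVertexRelations_observable {Λ : Finset HexVertex} (hΛ : hexDomainSimplyConnected Λ)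
    {a : Sym2 HexVertex} (ha : a ∈ hexDomainBoundary Λ) :
    SatisfiesVertexRelations Λ (hexParafermionicObservable Λ a hexCriticalFugacity (5 / 8)) :=
  (lemma1_iff.1 DuminilCopinSmirnov2012_lemma1_holds) Λ hΛ a ha

/-- **Total boundary flux, root split off**: for a boundary root `a = {u ∉ Λ, w ∈ Λ}` of a simply
connected `Λ`, the half-edge terms `(mid − c_v)·F({v,t})` over the boundary darts OTHER than the
root sum to `(c_w − c_u)/2` (the root dart contributes `(mid_a − c_w)·F(a) = (c_u − c_w)/2`,
`F(a) = 1`, and the total flux vanishes). [cite: DuminilCopinSmirnov2012, §3 (proof of Lemma 2, eq. (2))] -/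
theorem boundaryTerm_sum_eq {Λ : Finset HexVertex} (hΛ : hexDomainSimplyConnected Λ)
    {u w : HexVertex} (huw : hexGraph.Adj u w) (hu : u ∉ Λ) (hw : w ∈ Λ) :
    ∑ v ∈ Λ, ∑ t ∈ (nbrs v).filter (· ∉ Λ),
        (if v = w ∧ t = u then 0 else
          HexKernel.term (hexParafermionicObservable Λ s(u, w) hexCriticalFugacity (5 / 8)) v t) =
      (hexCenter w - hexCenter u) / 2 := by
  classical
  set F := hexParafermionicObservable Λ s(u, w) hexCriticalFugacity (5 / 8) with hF
  have ha : s(u, w) ∈ hexDomainBoundary Λ :=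
    ⟨(SimpleGraph.mem_edgeSet hexGraph).2 huw, u, w, rfl, hw, hu⟩
  have hflux : hexFlux Λ F = 0 :=
    hexFlux_eq_zero_of_satisfiesVertexRelations (satisfiesVertexRelations_observable hΛ ha)
  -- split every term into root part + rest
  have hsplit : ∀ v ∈ Λ, ∀ t ∈ (nbrs v).filter (· ∉ Λ), HexKernel.term F v t =
      (if v = w ∧ t = u then HexKernel.term F v t else 0) +
      (if v = w ∧ t = u then 0 else HexKernel.term F v t) := by
    intro v _ t _; split_ifs <;> simp
  have hroot : ∑ v ∈ Λ, ∑ t ∈ (nbrs v).filter (· ∉ Λ),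
      (if v = w ∧ t = u then HexKernel.term F v t else 0) = HexKernel.term F w u := by
    rw [Finset.sum_eq_single w, Finset.sum_eq_single u]
    · simp
    · intro t _ htu; rw [if_neg (fun h => htu h.2)]
    · intro hun
      exfalso; apply hun
      rw [Finset.mem_filter, mem_nbrs_iff]; exact ⟨huw.symm, hu⟩
    · intro v _ hvw
      exact Finset.sum_eq_zero fun t _ => by rw [if_neg (fun h => hvw h.1)]
    · intro hwn; exact absurd hw hwn
  have hterm : HexKernel.term F w u = (hexCenter u - hexCenter w) / 2 := by
    rw [HexKernel.term, Sym2.eq_swap, hF, hexParafermionicObservable_self ha, mul_one, hexMidpoint_mk]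
    ring
  have key : hexFlux Λ F = HexKernel.term F w u +
      ∑ v ∈ Λ, ∑ t ∈ (nbrs v).filter (· ∉ Λ),
        (if v = w ∧ t = u then 0 else HexKernel.term F v t) := by
    rw [hexFlux, ← hroot, ← Finset.sum_add_distrib]
    refine Finset.sum_congr rfl fun v hv => ?_
    rw [← Finset.sum_add_distrib]
    exact Finset.sum_congr rfl fun t ht => hsplit v hv t ht
  rw [hflux, hterm] at key
  linear_combination -key

/-- **The dressed arrival identity**: with `A := (c_w − c_u)/2` (the root's inward half-edge),
each non-root boundary dart reached by a walk `γ` contributes `A·e^{i(3/8)W(γ)}·Z({v,t})` ((E2)),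
unreached darts contribute `0`; hence `Σ_{darts ≠ root} D(v,t) = A` where
`D(v,t) := (mid − c_v)F({v,t})`, `‖D(v,t)‖ = ‖A‖·Z({v,t})`.  Here: the normalised real and
imaginary sums, `Σ Re(D/A) = 1` and `Σ Im(D/A) = 0`. [folklore] -/
theorem dressed_sum_re_im {Λ : Finset HexVertex}
    (hΛ : hexDomainSimplyConnected Λ) {u w : HexVertex} (huw : hexGraph.Adj u w) (hu : u ∉ Λ)
    (hw : w ∈ Λ) :
    (∑ v ∈ Λ, ∑ t ∈ (nbrs v).filter (· ∉ Λ),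
        (if v = w ∧ t = u then 0 else
          (HexKernel.term (hexParafermionicObservable Λ s(u, w) hexCriticalFugacity (5 / 8)) v t /
            ((hexCenter w - hexCenter u) / 2))).re) = 1 ∧
    (∑ v ∈ Λ, ∑ t ∈ (nbrs v).filter (· ∉ Λ),
        (if v = w ∧ t = u then 0 else
          (HexKernel.term (hexParafermionicObservable Λ s(u, w) hexCriticalFugacity (5 / 8)) v t /
            ((hexCenter w - hexCenter u) / 2))).im) = 0 := by
  classical
  have hA : (hexCenter w - hexCenter u) / 2 ≠ 0 :=
    div_ne_zero (Summit.CriticalPhenomena.SAWScalingLimit.Theorems.SpinShift.hexCenter_sub_ne_zero_of_adj huw)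
      two_ne_zero
  have key := boundaryTerm_sum_eq hΛ huw hu hw
  have key' : ∑ v ∈ Λ, ∑ t ∈ (nbrs v).filter (· ∉ Λ),
      (if v = w ∧ t = u then 0 else
        HexKernel.term (hexParafermionicObservable Λ s(u, w) hexCriticalFugacity (5 / 8)) v t /
          ((hexCenter w - hexCenter u) / 2)) = 1 := by
    have : ∀ v t, (if v = w ∧ t = u then (0 : ℂ) else
        HexKernel.term (hexParafermionicObservable Λ s(u, w) hexCriticalFugacity (5 / 8)) v t /
          ((hexCenter w - hexCenter u) / 2)) =
        (if v = w ∧ t = u then 0 else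
          HexKernel.term (hexParafermionicObservable Λ s(u, w) hexCriticalFugacity (5 / 8)) v t) /
          ((hexCenter w - hexCenter u) / 2) := by
      intro v t; split_ifs <;> simp
    simp_rw [this, ← Finset.sum_div, key, div_self hA]
  constructor
  · have h := congrArg Complex.re key'
    rw [Complex.re_sum] at h
    simp_rw [Complex.re_sum] at h
    rw [Complex.one_re] at h
    rw [← h]
  · have h := congrArg Complex.im key'
    rw [Complex.im_sum] at h
    simp_rw [Complex.im_sum] at h
    rw [Complex.one_im] at h
    rw [← h]

/-- No walk from a boundary root returns to it with winding `π`: walks `a → a` are trivial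
(`verts_eq_nil_of_mem_boundary`), of winding `0`. [folklore] -/
theorem not_exists_winding_eq_pi_self {Λ : Finset HexVertex} {a : Sym2 HexVertex}
    (ha : a ∈ hexDomainBoundary Λ) : ¬ ∃ γ : HexMidEdgeSAW Λ a a, γ.winding = Real.pi := by
  rintro ⟨γ, hγ⟩
  have h0 := HexMidEdgeSAW.verts_eq_nil_of_mem_boundary ha γ
  have : γ = HexMidEdgeSAW.trivial (hexDomainBoundary_subset Λ ha) := HexMidEdgeSAW.ext h0
  rw [this, HexMidEdgeSAW.winding_trivial] at hγ
  exact Real.pi_ne_zero hγ.symm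

/-- **TAME one-sided arrival bound (general simply connected domains).**  If every boundary
winding from the root lies in `[−π, π]` (no overturned boundary arc, as seen from the root), the
total critical arrival mass of the class of winding EXACTLY `+π` (for a floor root: the floor
edges west of the root, at any height of the ccw lift) is at most `1/(2cos(3π/8))` — the sharp
half-plane constant.  Proof: by (E2) each reached non-root dart has dressed value
`D = e^{i(3/8)W} Z`; per dart `cos(3π/8)·Im D + sin(3π/8)·Re D = Z·sin((3/8)(W + π)) ≥ 0`, with
EQUALITY `= 2 sin(3π/8)cos(3π/8)·Z` on the `π`-class; summing, `Σ Re D = 1`, `Σ Im D = 0`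
(`dressed_sum_re_im`) give `sin(3π/8) ≥ 2 sin(3π/8) cos(3π/8)·X`. [folklore] -/
theorem tame_piClass_mass_le {Λ : Finset HexVertex}
    (hΛ : hexDomainSimplyConnected Λ) {u w : HexVertex} (huw : hexGraph.Adj u w) (hu : u ∉ Λ)
    (hw : w ∈ Λ)
    (htame : ∀ v ∈ Λ, ∀ t : HexVertex, hexGraph.Adj v t → t ∉ Λ → ¬ (v = w ∧ t = u) →
      ∀ γ : HexMidEdgeSAW Λ s(u, w) s(t, v), γ.winding ∈ Set.Icc (-Real.pi) Real.pi) :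
    ∑ v ∈ Λ, ∑ t ∈ (nbrs v).filter (· ∉ Λ),
        (if ∃ γ : HexMidEdgeSAW Λ s(u, w) s(t, v), γ.winding = Real.pi then
          ‖hexParafermionicObservable Λ s(u, w) hexCriticalFugacity 0 s(t, v)‖ else 0) ≤
      1 / (2 * Real.cos (3 * Real.pi / 8)) := by
  classical
  set F := hexParafermionicObservable Λ s(u, w) hexCriticalFugacity (5 / 8) with hF
  set Z : HexVertex → HexVertex → ℝ := fun v t =>
    ‖hexParafermionicObservable Λ s(u, w) hexCriticalFugacity 0 s(t, v)‖ with hZ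
  set A : ℂ := (hexCenter w - hexCenter u) / 2 with hAdef
  set c := Real.cos (3 * Real.pi / 8) with hc
  set sn := Real.sin (3 * Real.pi / 8) with hsn
  have hA : A ≠ 0 :=
    div_ne_zero (Summit.CriticalPhenomena.SAWScalingLimit.Theorems.SpinShift.hexCenter_sub_ne_zero_of_adj huw)
      two_ne_zero
  have ha : s(u, w) ∈ hexDomainBoundary Λ :=
    ⟨(SimpleGraph.mem_edgeSet hexGraph).2 huw, u, w, rfl, hw, hu⟩
  have hc0 : 0 < c := Real.cos_pos_of_mem_Ioo ⟨by linarith [Real.pi_pos], by linarith [Real.pi_pos]⟩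
  have hsn0 : 0 < sn := by
    rw [hsn]; exact Real.sin_pos_of_pos_of_lt_pi (by positivity) (by linarith [Real.pi_pos])
  -- the dressed value of a dart and the per-dart inequality
  set D : HexVertex → HexVertex → ℂ := fun v t =>
    if v = w ∧ t = u then 0 else HexKernel.term F v t / A with hD
  have hdart : ∀ v ∈ Λ, ∀ t ∈ (nbrs v).filter (· ∉ Λ),
      2 * sn * c * (if ∃ γ : HexMidEdgeSAW Λ s(u, w) s(t, v), γ.winding = Real.pi then Z v t else 0)
        ≤ c * (D v t).im + sn * (D v t).re := by
    intro v hv t ht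
    rw [Finset.mem_filter, mem_nbrs_iff] at ht
    obtain ⟨hvt, htΛ⟩ := ht
    by_cases hroot : v = w ∧ t = u
    · obtain ⟨rfl, rfl⟩ := hroot
      have : ¬ ∃ γ : HexMidEdgeSAW Λ s(t, v) s(t, v), γ.winding = Real.pi :=
        not_exists_winding_eq_pi_self ha
      simp [hD, this]
    have hne : s(t, v) ≠ s(u, w) := by
      intro h
      rw [Sym2.eq_iff] at h
      rcases h with ⟨rfl, rfl⟩ | ⟨rfl, rfl⟩
      · exact hroot ⟨rfl, rfl⟩
      · exact hu hv
    -- the dressed value through (E2), for any walk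
    have hE2 : ∀ γ : HexMidEdgeSAW Λ s(u, w) s(t, v),
        D v t = Complex.exp ((((3 : ℝ) / 8 * γ.winding : ℝ) : ℂ) * Complex.I) * (Z v t : ℂ) := by
      intro γ
      have key := BoundaryExactness.boundaryExactness_phaseLaw Λ hΛ u w huw hu hw t v hvt.symm htΛ hv hne γ
      have hterm : HexKernel.term F v t = (hexMidpoint s(t, v) - hexCenter v) * F s(t, v) := by
        rw [HexKernel.term, Sym2.eq_swap]
      simp only [hD, if_neg hroot]
      rw [hterm, key, show Complex.I * (3 / 8 : ℂ) * (γ.winding : ℂ) =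
        (((3 : ℝ) / 8 * γ.winding : ℝ) : ℂ) * Complex.I by push_cast; ring]
      field_simp
      rw [hAdef, hZ]
      ring
    by_cases hπ : ∃ γ : HexMidEdgeSAW Λ s(u, w) s(t, v), γ.winding = Real.pi
    · obtain ⟨γ, hγ⟩ := hπ
      rw [if_pos ⟨γ, hγ⟩, hE2 γ, hγ, Complex.re_mul_ofReal, Complex.im_mul_ofReal,
        Complex.exp_ofReal_mul_I_re, Complex.exp_ofReal_mul_I_im,
        show (3 : ℝ) / 8 * Real.pi = 3 * Real.pi / 8 by ring]
      nlinarith [hc0, hsn0]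
    · rw [if_neg hπ, mul_zero]
      by_cases hex : Nonempty (HexMidEdgeSAW Λ s(u, w) s(t, v))
      · obtain ⟨γ⟩ := hex
        have hW := htame v hv t hvt htΛ hroot γ
        rw [hE2 γ, Complex.re_mul_ofReal, Complex.im_mul_ofReal, Complex.exp_ofReal_mul_I_re,
          Complex.exp_ofReal_mul_I_im]
        have hZ0 : 0 ≤ Z v t := norm_nonneg _
        have hsin : 0 ≤ Real.sin ((3 : ℝ) / 8 * γ.winding + 3 * Real.pi / 8) :=
          Real.sin_nonneg_of_nonneg_of_le_pi (by nlinarith [hW.1, Real.pi_pos])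
            (by nlinarith [hW.2, Real.pi_pos])
        rw [Real.sin_add] at hsin
        have : c * (Real.sin ((3 : ℝ) / 8 * γ.winding) * Z v t) +
            sn * (Real.cos ((3 : ℝ) / 8 * γ.winding) * Z v t) =
            (Real.sin ((3 : ℝ) / 8 * γ.winding) * Real.cos (3 * Real.pi / 8) +
              Real.cos ((3 : ℝ) / 8 * γ.winding) * Real.sin (3 * Real.pi / 8)) * Z v t := by
          rw [hc, hsn]; ring
        rw [this]
        exact mul_nonneg hsin hZ0
      · -- no walk: the observable vanishes on this edge
        have h0 : F s(t, v) = 0 := by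
          rw [hF, hexParafermionicObservable]
          haveI : IsEmpty (HexMidEdgeSAW Λ s(u, w) s(t, v)) := not_nonempty_iff.1 hex
          exact Finset.sum_of_isEmpty _
        have : D v t = 0 := by
          simp only [hD, if_neg hroot, HexKernel.term, Sym2.eq_swap (a := v), h0, mul_zero, zero_div]
        rw [this]; simp
  -- sum the per-dart inequality
  have hsum := Finset.sum_le_sum fun v hv => Finset.sum_le_sum (hdart v hv)
  have hreim := dressed_sum_re_im hΛ huw hu hw
  have hre : ∑ v ∈ Λ, ∑ t ∈ (nbrs v).filter (· ∉ Λ), (D v t).re = 1 := hreim.1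
  have him : ∑ v ∈ Λ, ∑ t ∈ (nbrs v).filter (· ∉ Λ), (D v t).im = 0 := hreim.2
  have hR : ∑ v ∈ Λ, ∑ t ∈ (nbrs v).filter (· ∉ Λ), (c * (D v t).im + sn * (D v t).re) = sn := by
    simp_rw [Finset.sum_add_distrib, ← Finset.mul_sum, him, hre]; ring
  have hL : ∑ v ∈ Λ, ∑ t ∈ (nbrs v).filter (· ∉ Λ),
      2 * sn * c * (if ∃ γ : HexMidEdgeSAW Λ s(u, w) s(t, v), γ.winding = Real.pi then Z v t else 0) =
      2 * sn * c * ∑ v ∈ Λ, ∑ t ∈ (nbrs v).filter (· ∉ Λ),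
        (if ∃ γ : HexMidEdgeSAW Λ s(u, w) s(t, v), γ.winding = Real.pi then Z v t else 0) := by
    simp_rw [Finset.mul_sum]
  rw [hR, hL] at hsum
  rw [le_div_iff₀ (by positivity)]
  nlinarith [hsum, hsn0, hc0]

/-- **General `π`-class budget**: for any simply connected `Λ` and boundary root `{u ∉ Λ, w ∈ Λ}`,
the arrival mass of the darts of winding class `+π` is at most `1/(2cos(3π/8))` plus the arrival
mass `B` of the darts whose winding leaves `[−π, π]`, weighted by `1/(2 sin(3π/8) cos(3π/8))` —
from the real and imaginary parts of the dressed identity (`dressed_sum_re_im`). [folklore] -/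
theorem piClass_mass_le_general {Λ : Finset HexVertex}
    (hΛ : hexDomainSimplyConnected Λ) {u w : HexVertex} (huw : hexGraph.Adj u w) (hu : u ∉ Λ)
    (hw : w ∈ Λ) :
    ∑ v ∈ Λ, ∑ t ∈ (nbrs v).filter (· ∉ Λ),
        (if ∃ γ : HexMidEdgeSAW Λ s(u, w) s(t, v), γ.winding = Real.pi then
          ‖hexParafermionicObservable Λ s(u, w) hexCriticalFugacity 0 s(t, v)‖ else 0) ≤
      1 / (2 * Real.cos (3 * Real.pi / 8)) +
      (∑ v ∈ Λ, ∑ t ∈ (nbrs v).filter (· ∉ Λ),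
        (if ∃ γ : HexMidEdgeSAW Λ s(u, w) s(t, v), γ.winding ∉ Set.Icc (-Real.pi) Real.pi then
          ‖hexParafermionicObservable Λ s(u, w) hexCriticalFugacity 0 s(t, v)‖ else 0)) /
        (2 * Real.sin (3 * Real.pi / 8) * Real.cos (3 * Real.pi / 8)) := by
  classical
  set F := hexParafermionicObservable Λ s(u, w) hexCriticalFugacity (5 / 8) with hF
  set Z : HexVertex → HexVertex → ℝ := fun v t =>
    ‖hexParafermionicObservable Λ s(u, w) hexCriticalFugacity 0 s(t, v)‖ with hZ
  set A : ℂ := (hexCenter w - hexCenter u) / 2 with hAdef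
  set c := Real.cos (3 * Real.pi / 8) with hc
  set sn := Real.sin (3 * Real.pi / 8) with hsn
  have hA : A ≠ 0 :=
    div_ne_zero (Summit.CriticalPhenomena.SAWScalingLimit.Theorems.SpinShift.hexCenter_sub_ne_zero_of_adj huw)
      two_ne_zero
  have ha : s(u, w) ∈ hexDomainBoundary Λ :=
    ⟨(SimpleGraph.mem_edgeSet hexGraph).2 huw, u, w, rfl, hw, hu⟩
  have hc0 : 0 < c := Real.cos_pos_of_mem_Ioo ⟨by linarith [Real.pi_pos], by linarith [Real.pi_pos]⟩
  have hsn0 : 0 < sn := by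
    rw [hsn]; exact Real.sin_pos_of_pos_of_lt_pi (by positivity) (by linarith [Real.pi_pos])
  -- the dressed value of a dart and the per-dart inequality
  set D : HexVertex → HexVertex → ℂ := fun v t =>
    if v = w ∧ t = u then 0 else HexKernel.term F v t / A with hD
  have hdart : ∀ v ∈ Λ, ∀ t ∈ (nbrs v).filter (· ∉ Λ),
      2 * sn * c * (if ∃ γ : HexMidEdgeSAW Λ s(u, w) s(t, v), γ.winding = Real.pi then Z v t else 0)
        - (if ∃ γ : HexMidEdgeSAW Λ s(u, w) s(t, v), γ.winding ∉ Set.Icc (-Real.pi) Real.pi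
            then Z v t else 0)
        ≤ c * (D v t).im + sn * (D v t).re := by
    intro v hv t ht
    rw [Finset.mem_filter, mem_nbrs_iff] at ht
    obtain ⟨hvt, htΛ⟩ := ht
    by_cases hroot : v = w ∧ t = u
    · obtain ⟨rfl, rfl⟩ := hroot
      have : ¬ ∃ γ : HexMidEdgeSAW Λ s(t, v) s(t, v), γ.winding = Real.pi :=
        not_exists_winding_eq_pi_self ha
      have hZ0 : 0 ≤ Z v t := norm_nonneg _
      have : 2 * sn * c * (0 : ℝ) - (if ∃ γ : HexMidEdgeSAW Λ s(t, v) s(t, v),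
          γ.winding ∉ Set.Icc (-Real.pi) Real.pi then Z v t else 0) ≤ 0 := by
        split_ifs <;> nlinarith
      simpa [hD, not_exists_winding_eq_pi_self ha] using this
    have hne : s(t, v) ≠ s(u, w) := by
      intro h
      rw [Sym2.eq_iff] at h
      rcases h with ⟨rfl, rfl⟩ | ⟨rfl, rfl⟩
      · exact hroot ⟨rfl, rfl⟩
      · exact hu hv
    -- the dressed value through (E2), for any walk
    have hE2 : ∀ γ : HexMidEdgeSAW Λ s(u, w) s(t, v),
        D v t = Complex.exp ((((3 : ℝ) / 8 * γ.winding : ℝ) : ℂ) * Complex.I) * (Z v t : ℂ) := by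
      intro γ
      have key := BoundaryExactness.boundaryExactness_phaseLaw Λ hΛ u w huw hu hw t v hvt.symm htΛ hv hne γ
      have hterm : HexKernel.term F v t = (hexMidpoint s(t, v) - hexCenter v) * F s(t, v) := by
        rw [HexKernel.term, Sym2.eq_swap]
      simp only [hD, if_neg hroot]
      rw [hterm, key, show Complex.I * (3 / 8 : ℂ) * (γ.winding : ℂ) =
        (((3 : ℝ) / 8 * γ.winding : ℝ) : ℂ) * Complex.I by push_cast; ring]
      field_simp
      rw [hAdef, hZ]
      ring
    by_cases hπ : ∃ γ : HexMidEdgeSAW Λ s(u, w) s(t, v), γ.winding = Real.pi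
    · obtain ⟨γ, hγ⟩ := hπ
      rw [if_pos ⟨γ, hγ⟩, hE2 γ, hγ, Complex.re_mul_ofReal, Complex.im_mul_ofReal,
        Complex.exp_ofReal_mul_I_re, Complex.exp_ofReal_mul_I_im,
        show (3 : ℝ) / 8 * Real.pi = 3 * Real.pi / 8 by ring]
      have hZ0 : 0 ≤ Z v t := norm_nonneg _
      have hbad : 0 ≤ (if ∃ γ : HexMidEdgeSAW Λ s(u, w) s(t, v),
          γ.winding ∉ Set.Icc (-Real.pi) Real.pi then Z v t else 0) := by
        split_ifs <;> simp [hZ0]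
      nlinarith [hc0, hsn0, hbad]
    · rw [if_neg hπ, mul_zero]
      have hZ0 : 0 ≤ Z v t := norm_nonneg _
      by_cases hbadex : ∃ γ : HexMidEdgeSAW Λ s(u, w) s(t, v), γ.winding ∉ Set.Icc (-Real.pi) Real.pi
      · -- a bad dart: `c·Im D + s·Re D = Z sin(…) ≥ -Z`
        rw [if_pos hbadex]
        obtain ⟨γ, -⟩ := hbadex
        rw [hE2 γ, Complex.re_mul_ofReal, Complex.im_mul_ofReal, Complex.exp_ofReal_mul_I_re,
          Complex.exp_ofReal_mul_I_im]
        have hcs : c * (Real.sin ((3 : ℝ) / 8 * γ.winding) * Z v t) +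
            sn * (Real.cos ((3 : ℝ) / 8 * γ.winding) * Z v t) =
            Real.sin ((3 : ℝ) / 8 * γ.winding + 3 * Real.pi / 8) * Z v t := by
          rw [Real.sin_add, hc, hsn]; ring
        rw [hcs]
        nlinarith [Real.neg_one_le_sin ((3 : ℝ) / 8 * γ.winding + 3 * Real.pi / 8), hZ0]
      rw [if_neg hbadex, sub_zero]
      by_cases hex : Nonempty (HexMidEdgeSAW Λ s(u, w) s(t, v))
      · obtain ⟨γ⟩ := hex
        have hW : γ.winding ∈ Set.Icc (-Real.pi) Real.pi := by
          by_contra h; exact hbadex ⟨γ, h⟩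
        rw [hE2 γ, Complex.re_mul_ofReal, Complex.im_mul_ofReal, Complex.exp_ofReal_mul_I_re,
          Complex.exp_ofReal_mul_I_im]
        have hsin : 0 ≤ Real.sin ((3 : ℝ) / 8 * γ.winding + 3 * Real.pi / 8) :=
          Real.sin_nonneg_of_nonneg_of_le_pi (by nlinarith [hW.1, Real.pi_pos])
            (by nlinarith [hW.2, Real.pi_pos])
        rw [Real.sin_add] at hsin
        have : c * (Real.sin ((3 : ℝ) / 8 * γ.winding) * Z v t) +
            sn * (Real.cos ((3 : ℝ) / 8 * γ.winding) * Z v t) =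
            (Real.sin ((3 : ℝ) / 8 * γ.winding) * Real.cos (3 * Real.pi / 8) +
              Real.cos ((3 : ℝ) / 8 * γ.winding) * Real.sin (3 * Real.pi / 8)) * Z v t := by
          rw [hc, hsn]; ring
        rw [this]
        exact mul_nonneg hsin hZ0
      · -- no walk: the observable vanishes on this edge
        have h0 : F s(t, v) = 0 := by
          rw [hF, hexParafermionicObservable]
          haveI : IsEmpty (HexMidEdgeSAW Λ s(u, w) s(t, v)) := not_nonempty_iff.1 hex
          exact Finset.sum_of_isEmpty _
        have : D v t = 0 := by
          simp only [hD, if_neg hroot, HexKernel.term, Sym2.eq_swap (a := v), h0, mul_zero, zero_div]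
        rw [this]; simp
  -- sum the per-dart inequality
  have hsum := Finset.sum_le_sum fun v hv => Finset.sum_le_sum (hdart v hv)
  have hreim := dressed_sum_re_im hΛ huw hu hw
  have hre : ∑ v ∈ Λ, ∑ t ∈ (nbrs v).filter (· ∉ Λ), (D v t).re = 1 := hreim.1
  have him : ∑ v ∈ Λ, ∑ t ∈ (nbrs v).filter (· ∉ Λ), (D v t).im = 0 := hreim.2
  have hR : ∑ v ∈ Λ, ∑ t ∈ (nbrs v).filter (· ∉ Λ), (c * (D v t).im + sn * (D v t).re) = sn := by
    simp_rw [Finset.sum_add_distrib, ← Finset.mul_sum, him, hre]; ring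
  have hL : ∑ v ∈ Λ, ∑ t ∈ (nbrs v).filter (· ∉ Λ),
      (2 * sn * c * (if ∃ γ : HexMidEdgeSAW Λ s(u, w) s(t, v), γ.winding = Real.pi then Z v t else 0)
        - (if ∃ γ : HexMidEdgeSAW Λ s(u, w) s(t, v), γ.winding ∉ Set.Icc (-Real.pi) Real.pi
            then Z v t else 0)) =
      2 * sn * c * (∑ v ∈ Λ, ∑ t ∈ (nbrs v).filter (· ∉ Λ),
        (if ∃ γ : HexMidEdgeSAW Λ s(u, w) s(t, v), γ.winding = Real.pi then Z v t else 0)) -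
      ∑ v ∈ Λ, ∑ t ∈ (nbrs v).filter (· ∉ Λ),
        (if ∃ γ : HexMidEdgeSAW Λ s(u, w) s(t, v), γ.winding ∉ Set.Icc (-Real.pi) Real.pi
            then Z v t else 0) := by
    simp_rw [Finset.sum_sub_distrib, Finset.mul_sum]
  rw [hR, hL] at hsum
  set X := ∑ v ∈ Λ, ∑ t ∈ (nbrs v).filter (· ∉ Λ),
    (if ∃ γ : HexMidEdgeSAW Λ s(u, w) s(t, v), γ.winding = Real.pi then Z v t else 0)
  set B := ∑ v ∈ Λ, ∑ t ∈ (nbrs v).filter (· ∉ Λ),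
    (if ∃ γ : HexMidEdgeSAW Λ s(u, w) s(t, v), γ.winding ∉ Set.Icc (-Real.pi) Real.pi
      then Z v t else 0)
  have hsc : 0 < 2 * sn * c := by positivity
  rw [div_add_div _ _ (by positivity) hsc.ne', le_div_iff₀ (by positivity)]
  nlinarith [hsum, hsn0, hc0, mul_pos hsn0 hc0]

/-- Registered sub-goal `stub_halfPlaneInputs_piClassBudget` of crux stmt-CriticalPhenomena-14004
(line `pick-half-plane`): the closed form of `piClass_mass_le_general`. [folklore] -/
theorem stub_halfPlaneInputs_piClassBudget : ∀ (Λ : Finset HexVertex), hexDomainSimplyConnected Λ → ∀ (u w : HexVertex), hexGraph.Adj u w → u ∉ Λ → w ∈ Λ → (∑ v ∈ Λ, ∑ t ∈ (nbrs v).filter (· ∉ Λ), (if ∃ γ : HexMidEdgeSAW Λ s(u, w) s(t, v), γ.winding = Real.pi then ‖hexParafermionicObservable Λ s(u, w) hexCriticalFugacity 0 s(t, v)‖ else 0)) ≤ 1 / (2 * Real.cos (3 * Real.pi / 8)) + (∑ v ∈ Λ, ∑ t ∈ (nbrs v).filter (· ∉ Λ), (if ∃ γ : HexMidEdgeSAW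 Λ s(u, w) s(t, v), γ.winding ∉ Set.Icc (-Real.pi) Real.pi then ‖hexParafermionicObservable Λ s(u, w) hexCriticalFugacity 0 s(t, v)‖ else 0)) / (2 * Real.sin (3 * Real.pi / 8) * Real.cos (3 * Real.pi / 8)) :=
  fun _ hΛ _ _ huw hu hw => piClass_mass_le_general hΛ huw hu hw

end Summit.CriticalPhenomena.SAWScalingLimit.Theorems.PickHalfPlane.Dressed
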